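import Mathlib
import HarnessLib
import HarnessLib.Audit
import Summits.Schanuel.Statement
import HarnessLib.Audit.Status.Attr

/-!
Route: GaussianStokesSector

DORMANT since 2026-08-24T08:57:56Z (reconciler: no traction for 6.6 d (last activity item-evidence-added at 2026-08-17T16:54:20Z); parked, not closed — `ledger route dormant route-Schanuel-GaussianStokesSector --off` to reactivate) — unstaffed, not closed; items shared with open routes are served there. `ledger route dormant <id> --off` reactivates.

# Route GaussianStokesSector — π as the Stokes constant of the Gaussian E-operator — Schanuel = (π
free over LW- and Gaussian E-values, a mixed E/Э Siegel–Shidlovskii step) ∧ (relative Schanuel over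
ℚ(πi, ℚ̄, e^ℚ̄))

It suffices to show X = PiFreeOverGaussianEValues ∧ RelSchanuelOverPiLWField. Factorise Schanuel
EXACTLY along the ℚ-subspace
V₂ = ℚ̄ ⊕ ℚπi (Assembly: PiFreeOverLWField → RelSchanuelOverPiLWField → Schanuel; Exactness:
Schanuel ⇒ both; the two factor decls and
the Assembly are shared verbatim with route ExceptionalSubspaces). Factor 1, "π is transcendental
over the Lindemann–Weierstrass field"
(Schanuel at (πi, a₁,…,a_d), aⱼ algebraic; d = 1, a = 1 is e ⊥ π), is attacked through ONE
confluent-hypergeometric E-operator: with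
F(a) := ∫₀¹ e^{-a x²} dx (an E-value) and H(a) := ∫₀^∞ e^{-x}(1 + x/a)^{-1/2} dx (an Э-value,
Borel–Laplace 1-sum of Σ (−½)(−3⁄2)⋯(½−n) zⁿ)
one has √(πa) = 2aF(a) + e^{-a}H(a) at every algebraic a: √π is the STOKES CONSTANT joining the
E-basis and the Э-basis of the system
Y = (1, e^{-z}, F, H), Y′ = AY, A ∈ M₄(ℚ(z)). Siegel–Shidlovskii (PROVED in the tree) gives trdeg
ℚ(e^{a_i}, F(a_i)) = 2d for ℚ-free
algebraic a; the rank-2 crux PiFreeOverGaussianEValues asks for 2d + 1 once π (equivalently any one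
Э-value H(a_j)) is adjoined — the
numerical side of a Siegel–Shidlovskii EQUALITY for the mixed E/Э system, whose functional side
(trdeg 2d+1 over ℚ̄(z)) is a theorem
because π ∉ ℚ̄. Dropping the d values F(a_i) (StokesToSector) yields Factor 1; d = 1, a = 1 is the
card's 3-number reduction
MixedTripleIndependent (e, ∫₀¹e^{-x²}dx, ∫₀^∞e^{-x}/√(1+x)dx algebraically independent; "2 of 3"
known). Realises card
e-pi-obstruction-tate-gevrey (exit 4a, lifted from the instance to the whole π–LW sector);
supersedes the retired instance route StokesConstantPi.
Every item is stated over Mathlib alone: the route file imports no Literature module (cone repair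
2026-08-15, see DEFINITION REQUESTS).
Lean: `(∀ (d : ℕ) (a : Fin d → ℂ), (∀ i, IsAlgebraic ℚ (a i)) → LinearIndependent ℚ a → ((2 * d + 1
: ℕ) : Cardinal) ≤ Algebra.trdeg ℚ ↥(IntermediateField.adjoin ℚ (insert (Real.pi : ℂ) (Set.range
(Complex.exp ∘ a) ∪ Set.range (fun i => ∫ x in (0:ℝ)..1, Complex.exp (-(a i * (x : ℂ) ^ 2))))))) ∧
(∀ (n : ℕ) (x : Fin n → ℂ), LinearIndependent ℚ ((Submodule.span ℚ ({z : ℂ | IsAlgebraic ℚ z} ∪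
{(Real.pi : ℂ) * Complex.I})).mkQ ∘ x) → (n : Cardinal) ≤ Algebra.trdeg ↥(IntermediateField.adjoin ℚ
({z : ℂ | IsAlgebraic ℚ z} ∪ {(Real.pi : ℂ) * Complex.I} ∪ Complex.exp '' {z : ℂ | IsAlgebraic ℚ
z})) ↥(IntermediateField.adjoin ↥(IntermediateField.adjoin ℚ ({z : ℂ | IsAlgebraic ℚ z} ∪ {(Real.pi
: ℂ) * Complex.I} ∪ Complex.exp '' {z : ℂ | IsAlgebraic ℚ z})) (Set.range x ∪ Set.range (Complex.exp
∘ x))))`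

## Assembly
Standard sector reduction (as ExceptionalSubspaces.Assembly / LogPatterns.Assembly and the tree's
`schanuelConjecture_iff_ecl_empty_holds`):
given z ∈ ℂⁿ ℚ-linearly independent, let W = span_ℚ(z) ∩ V₂ (dim k) and change basis by P ∈ GL_n(ℚ)
to (w, z′) with w a basis of W and z′
ℚ-independent modulo V₂ (trdeg is GL_n(ℚ)-invariant since e^{(Pz)_i} is a radical monomial in the
e^{z_j}); Schanuel on w ⊂ V₂ is
Lindemann–Weierstrass (tree theorem `algebraicIndependent_exp_holds`) when πi ∉ W or W = U ⊕ ℚ(πi +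
a₀), and PiFreeOverLWField when πi ∈ W;
then trdeg ℚ(z, e^z) ≥ trdeg ℚ(w, e^w) + trdeg_{K₂} K₂(z′, e^{z′}) ≥ k + (n − k) by the tower law
and RelSchanuelOverPiLWField. The route's own
contribution enters one step earlier: PiFreeOverLWField := StokesToSector PiFreeOverGaussianEValues.
DECIDING THEOREM (glue.lean, kernel-checked
in Sketch.lean with imports Mathlib + Summits.Schanuel.Statement only, axioms
propext/Classical.choice/Quot.sound):
`closes (hStokes : PiFreeOverGaussianEValues) … (hExact : Exactness) (hAssembly : Assembly) :
Schanuel := hAssembly (hSector hStokes) hRel`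
— hypotheses = all 13 items (4 cruxes, 8 supports, 1 assembly), conclusion = `Schanuel`.

Rationale: WHY THIS LINE. The card's obstruction analysis says why nothing on the TAYLOR side sees e and π
together (e is Gevrey −1, π is Gevrey 0: no common integral normalisation of jets, criterion caps at
trdeg 1; the modular corner at q = 1/e returns "all invariants −1", NesterenkoPhilippon2001 Ch. 3)
and points to the LAPLACE side: π is not an E-value but it is the Stokes constant of E-operators, √π
= 2∫₀¹e^{-x²} + e⁻¹∫₀^∞e^{-x}/√(1+x) (FischlerRivoal2024 = arXiv:2301.13518 Prop. 3 at a = ½, s = 0;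
Thm 1 there: every G-value, "the number π" included, is a ℚ̄-polynomial in E-values and Э-values).
Imported area: the arithmetic of E-operators and arithmetic Gevrey series
(Siegel–Shidlovskii–Beukers, PROVED in the tree as
`Literature.Barriers.Schanuel.siegelShidlovskii_algIndep_holds`; André's E/Э duality
Andre2000GevreyI; Borel–Laplace summation, tree
`Literature.NumberTheory.Transcendental.antiEValues`; Fischler–Rivoal's rings E, G, D and mixed
functions with the conditional transfer theorems Thm 3/Thm 4 under Conj. 2/3) and, as the
conjectural umbrella, exponential periods/motives (Fresan2024 Ex. 2.9–2.10: e^α is expected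
transcendental over the field of ALL classical periods, √π is an exponential period;
FresanJossen2020): every number in Factor 1's attack — e^{a}, F(a), H(a), √π — is the value at an
algebraic point of a solution of one linear ODE over ℚ(z) and an exponential period over ℚ̄. What
the line does that others do not: the same identity at EVERY algebraic point turns the whole π–LW
sector of Schanuel (infinitely many open instances: e ⊥ π, π ⊥ e^{√2}, π ⊥ e^{i}, d ≥ 2) into "+1
over a transcendence degree the tree already proves", uniformly in d, the +1 being carried by a
single Э-value of the same system; ExceptionalSubspaces attacks the same factor through
exponential-ring endomorphisms of ℂ that are not known to exist, the retired StokesConstantPi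
reached only the instance, and no other Schanuel route uses E/Э arithmetic. No probabilistic,
spectral or model-theoretic reformulation is used: none of them carries arithmetic specific to
exp(1). In Lean every item is stated over Mathlib alone: the tree's E/Э notions are cited
informally, never imported, so the route's import cone is the Statement's own.

RANKED CRUXES. #2 PiFreeOverGaussianEValues (crux) — for every d and every ℚ-linearly independent
family of algebraic numbers a₁,…,a_d, trdeg_ℚ ℚ(π, e^{a₁},…,e^{a_d}, F(a₁),…,F(a_d)) ≥ 2d + 1 with
F(a) = ∫₀¹ e^{-a x²}dx = ₁F₁(½; 3⁄2; −a): π is transcendental over the field generated by the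
Lindemann–Weierstrass values and the Gaussian E-values (equivalently, by √(πa_j) = 2a_jF(a_j) +
e^{-a_j}H(a_j): the field of ALL values, E and Э, of the mixed system at the points a_i has
transcendence degree 2d + 1 = its functional transcendence degree over ℚ̄(z)). The 2d part is
GaussianEValuesIndependent (known); the crux is the +1. d = 1, a = 1 is MixedTripleIndependent
(InstanceFromSector + StokesSplit); dropping the F's gives PiFreeOverLWField (StokesToSector). Card
items (4a)/C1 lifted to the sector. [difficulty: open-problem] (why it might fail: Stronger than
Factor 1 and NOT implied by Schanuel (F-values lie outside exp/log): false iff π ∈ ℚ(e^{a},F(a))^alg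
for some a; products of mixed functions are not mixed, so no method in print yields trdeg of mixed
values (F–R 2024: 'no hope' by Beukers' route).) [FischlerRivoal2024, arXiv:2301.13518, Rivoal2012,
Shidlovskii1989, Andre2000GevreyI, Fresan2024, FresanJossen2020]
#3 MixedTripleIndependent (crux) — e, I := ∫₀¹ e^{-x²}dx (the Gaussian E-value F(1) = γ(½,1)/2) and
J := ∫₀^∞ e^{-x}/√(1+x) dx (the Gaussian Э-value H(1) = e·Γ(½,1)) are algebraically independent over
ℚ — the values at z = 1 of the solutions e^{-z}, F, H of one linear ODE over ℚ(z); by StokesSplit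
equivalent to trdeg ℚ(e, π, ∫₀¹e^{-x²}dx) = 3, hence it contains e ⊥ π. Card item C1 ("3 numbers, 2
of 3 known": trdeg ℚ(e, I) = 2 is Shidlovskii's theorem / Rivoal2012 Thm 2); the d = 1, a = 1 case
of PiFreeOverGaussianEValues and the first test-bed for any Э-value technology (Fischler–Rivoal
Conj. 2–3, resurgence, the tensor-mixed card). [difficulty: open-problem] (why it might fail:
Formally stronger than e ⊥ π (adds I); fails iff √π ∈ ℚ(e, I)^alg; unconditionally only trdeg ℚ(e,
I) = 2 is known, the linear and Э rungs are conditional (F–R Thm 4 / Cor. 1 under Conj. 3 / 2), and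
J could be algebraic without contradicting any theorem.) [Rivoal2012, FischlerRivoal2024,
arXiv:2301.13518, Shidlovskii1989, Lagarias2013EulerConstant]
#4 RelSchanuelOverPiLWField (crux) — the exact complement (Factor 2, shared verbatim with
ExceptionalSubspaces.RelSchanuelOverPiLWField): for x₁,…,x_n ∈ ℂ ℚ-linearly independent modulo V₂ =
span_ℚ(ℚ̄ ∪ {πi}) = ℚ̄ ⊕ ℚπi, the transcendence degree of K₂(x, e^x) over K₂ = ℚ(ℚ̄ ∪ {πi} ∪ e^ℚ̄)
is at least n — Schanuel relative to the field of the π–LW sector. Implied by Schanuel (Exactness).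
No mechanism of this route touches it; it is carried so that the route decides the summit, and it is
the same ledger item as in ExceptionalSubspaces (and of the same shape as LogPatterns.OffLogSector).
[difficulty: open-problem] (why it might fail: It is Schanuel off the π–LW sector verbatim (contains
algebraic independence of logarithms, e ⊥ e^e relative to K₂); no mechanism of this route touches it
— the honest remainder of an exact factorisation; false iff Schanuel fails for a tuple independent
mod ℚ̄ ⊕ ℚπi.) [Waldschmidt2000, Kirby2010EAEF, Lang1966, BaysKirby2018ANT]
#5 PiFreeOverLWField (crux) — Factor 1 (shared verbatim with
ExceptionalSubspaces.PiFreeOverLWField): for every d and every ℚ-linearly independent family of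
algebraic numbers a₁,…,a_d, trdeg_ℚ ℚ(π, e^{a₁},…,e^{a_d}) ≥ d + 1 — π is transcendental over the
Lindemann–Weierstrass field (Schanuel at (πi, a₁,…,a_d); d = 0 Lindemann, d = 1 ∋ e ⊥ π, π ⊥ e^{√2},
π ⊥ e^{i}). In THIS route it is reached from PiFreeOverGaussianEValues by StokesToSector; it stays
claimable directly and is predicted by the exponential period conjecture ("e^α transcendental over
the field of all classical periods", Fresan2024 Ex. 2.9). [deps: PiFreeOverGaussianEValues]
[difficulty: open-problem] (why it might fail: Contains e ⊥ π and π ⊥ e^{√2}; nothing beyond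
Lindemann–Weierstrass is known for any d ≥ 1, and here it is reached only through the stronger
Gaussian crux (or ExceptionalSubspaces' symmetry attack); false iff π is algebraic over some
ℚ(e^{a₁},…,e^{a_d}).) [Waldschmidt2000, BaysKirby2018ANT, Fresan2024, FresanJossen2020]
#9 StokesToSector (support) — PiFreeOverGaussianEValues → PiFreeOverLWField: adjoining the d numbers
F(a_i) to ℚ(π, e^{a}) raises the transcendence degree by at most d, so trdeg ℚ(π, e^{a}) ≥ (2d+1) −
d (tower law / `Algebra.trdeg` monotonicity and sub-additivity for `IntermediateField.adjoin`; pure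
field bookkeeping, the glue of the route's attack on Factor 1). [difficulty: L] [Lang1966,
Mathlib:Algebra.trdeg]
#9 GaussianEValuesIndependent (support) — KNOWN (the "2d of 2d+1"): for ℚ-linearly independent
algebraic a₁,…,a_d the 2d numbers e^{a_i}, F(a_i) = ∫₀¹e^{-a_i x²}dx are algebraically independent
over ℚ. Proof route in the tree: the coefficient sequences ((−a_i)ⁿ)ₙ and ((−a_i)ⁿ/(2n+1))ₙ are
strict E-functions (`IsStrictEFunction`: holonomy 2zF″ + (2z+3)F′ + F = 0, conjugates ≤ C^{n+1},
denominators den(a_i)ⁿ·lcm(1,3,…,2n+1) ≤ D^{n+1}); the system T(z)Y′ = BY with T = 2z (e_i′ = −a_i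
e_i, 2zF_i′ = e_i − F_i); functional algebraic independence of (z, e^{-a_i z}, F(a_i z)) over ℚ̄
(exponentials of ℚ-free exponents + Kolchin–Ostrowski/Liouville: no ℂ-combination of the primitives
√z·F(a_i z) of e^{-a_i z}/(2√z) lies in ℂ(√z, e^{-a_j z})); then `siegelShidlovskii_algIndep_holds`
at α = 1 (independence over ℚ̄, a fortiori over ℚ). Classical: Shidlovskii's theorems on E-functions
satisfying first-order inhomogeneous equations (φ_λ, λ = ½; Salikhov 1973); d = 1: Rivoal2012 Thm 2.
[difficulty: L] [Shidlovskii1989, doi:10.1007/bf01093623, Rivoal2012, BakerTNT1975, Rivoal2024,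
Literature.Barriers.Schanuel.siegelShidlovskii_algIndep_holds]
#9 FunctionalIndependence (support) — the FUNCTIONAL side of the mixed system at d = 1, provable
now: no nonzero polynomial in four variables with algebraic coefficients vanishes identically on (0,
∞) at (z, e^{-z}, F(z), H(z)), F(z) = ∫₀¹e^{-zx²}dx, H(z) = ∫₀^∞e^{-x}(1+x/z)^{-1/2}dx — although
over ℂ(z) the relation 2zF + e^{-z}H = √(πz) holds: trdeg is 2 over ℂ(z) and 3 over ℚ̄(z) exactly
because π ∉ ℚ̄ (tree `transcendental_pi_holds`); proof: ℂ-independence of (√z, e^{-z}, F) +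
specialising the free constant c = √π (a polynomial identity in c over ℚ̄ vanishing at the
transcendental √π vanishes for all c). This is the statement whose numerical twin at z = 1 is
MixedTripleIndependent. [difficulty: M] [Lindemann1882, FischlerRivoal2024, Shidlovskii1989,
Literature.NumberTheory.Transcendental.transcendental_pi_holds]
#9 StokesIdentity (support) — the Stokes identity at z = 1, provable now: √π = 2∫₀¹e^{-x²}dx +
e⁻¹∫₀^∞e^{-x}/√(1+x)dx (Γ(½) = √π = γ(½,1) + Γ(½,1); t = x² on (0,1), t = 1 + x on (1,∞); Mathlib
`Real.Gamma_one_half_eq`, `Real.Gamma_eq_integral`). It is Fischler–Rivoal's Γ(a) = E_{a,1}(−1) +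
e^{-1}Э_{a,1;0}(1) at a = ½ and exhibits √π ∈ ℚ̄[E, D] (their Thm 1 for the G-value π). Checked
numerically to 1e-13 (I = 0.7468241328…, J = 0.7578721561…). [difficulty: provable-now]
[arXiv:2301.13518, Mathlib:Real.Gamma_one_half_eq]
#9 StokesSplit (support) — provable now from StokesIdentity: MixedTripleIndependent ↔ (e, π,
∫₀¹e^{-x²}dx) algebraically independent — ℚ(e, I, J) = ℚ(e, I, √π) since J = e(√π − 2I) and √π = 2I
+ J/e, and adjoining √π or π gives the same algebraic closure. [difficulty: M] [arXiv:2301.13518,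
Mathlib:AlgebraicIndependent]
#9 InstanceFromSector (support) — bookkeeping, provable now: PiFreeOverGaussianEValues at d = 1, a =
(1) gives trdeg ℚ(π, e, ∫₀¹e^{-x²}dx) ≥ 3 inside ℂ, hence the three generators are algebraically
independent, and the real triple (e, π, ∫₀¹e^{-x²}dx) is algebraically independent over ℚ (transport
along the injective algebra map ℝ → ℂ; the complex integral ∫₀¹ e^{-(1·x²)} is the image of the real
one). With StokesSplit: PiFreeOverGaussianEValues ⇒ MixedTripleIndependent (kernel-checked
composition in the planner sketch). [difficulty: L] [Mathlib:Algebra.trdeg,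
Mathlib:AlgebraicIndependent]
#9 AntiEValueTranscendental (support) — the Э-RUNG (weakest consequence of MixedTripleIndependent,
and the refuters' handle): J = ∫₀^∞ e^{-x}/√(1+x) dx = e·Γ(½,1) is transcendental. In print only
conditionally: Fischler–Rivoal Cor. 1 (s = −½, α = 1) under their Conjecture 2; its s = −1 sibling
is Gompertz's constant δ, irrationality open. ¬AntiEValueTranscendental ⇒ √π ∈ ℚ̄(e, I) ⇒
¬MixedTripleIndependent ⇒ ¬PiFreeOverGaussianEValues (d = 1): one algebraicity kills the route's
whole attack (not Schanuel). [difficulty: open-problem] [FischlerRivoal2024, arXiv:2301.13518,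
Rivoal2012, Lagarias2013EulerConstant]
#9 Exactness (support) — the factorisation loses nothing (shared verbatim with
ExceptionalSubspaces.Exactness), provable now (L): Schanuel ⇒ PiFreeOverLWField (Schanuel at (πi,
a₁,…,a_d): ℚ-free because π is transcendental; e^{πi} = −1) and Schanuel ⇒ RelSchanuelOverPiLWField
(finite-coefficient descent K₂ → ℚ(w, e^w) for a finite-dimensional W ⊂ V₂ containing πi; Schanuel
at (w, x); trdeg ℚ(w, e^w) ≤ dim W on V₂; tower law). NOT claimed: Schanuel ⇒
PiFreeOverGaussianEValues (it does not follow; the Gaussian crux is a genuinely stronger bet).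
[difficulty: L] [Waldschmidt2000, Kirby2010EAEF,
Literature.NumberTheory.Transcendental.schanuelConjecture_iff_ecl_empty_holds]

TWO-LAYER PLAN. Foreseen glued splits (k ≤ 3, depth 1), filed only when something lands: (i)
PiFreeOverGaussianEValues ⇐ MixedTransferGaussian → FunctionalIndependenceFamily →
PiFreeOverGaussianEValues, where MixedTransferGaussian is the Beukers-shaped transfer "every
ℚ̄-algebraic relation among the values at z = 1 of (e^{-a_i z}, F(a_i z), H(a₁z)) is the
specialisation of a ℚ̄[z]-relation among the functions" (the mixed Siegel–Shidlovskii principle at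
this system — the item an E-function prover attacks; H typed on (0,∞) as in FunctionalIndependence)
and FunctionalIndependenceFamily is the provable d-point version of FunctionalIndependence
(trdeg_{ℚ̄(z)} = 2d + 1: Lindemann + Kolchin–Ostrowski); (ii) MixedTripleIndependent ⇐
MixedTransferAtOne → FunctionalIndependence → MixedTripleIndependent (d = 1 of (i)); (iii) a LINEAR
RUNG MixedLinearIndependence (1, e⁻¹, I, J ℚ̄-linearly independent: Fischler–Rivoal Thm 4 for the
mixed system, in print under their Conj. 3) as a cheaper child of MixedTripleIndependent if provers
want the place where existing conditional technology bites; (iv) GaussianEValuesIndependent ⇐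
(strictness of the 2d coefficient sequences + system) → (functional independence of the E-side) →
via `siegelShidlovskii_algIndep_holds`. RelSchanuelOverPiLWField is deliberately not decomposed here
(LogPatterns / AdelicLogSector / ExceptionalSubspaces share it).

KILL CRITERIA. MixedTripleIndependent refuted by a relation NOT involving ∫₀¹e^{-x²} ⇒ ¬(e ⊥ π) ⇒
PiFreeOverLWField and Schanuel refuted — every route on the summit closes `refuted`.
MixedTripleIndependent refuted by a relation involving ∫₀¹e^{-x²}, or AntiEValueTranscendental
refuted (J algebraic ⇒ √π ∈ ℚ̄(e, I)), refutes PiFreeOverGaussianEValues at d = 1 while leaving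
Schanuel untouched: the Stokes attack is dead, close `refuted:PiFreeOverGaussianEValues` (the
factorisation survives only as ExceptionalSubspaces' — i.e. `superseded --by
route-Schanuel-ExceptionalSubspaces`). A mixed E/Э system elsewhere whose functions are
algebraically independent over ℚ̄(z) but whose values at a regular algebraic point are dependent
refutes the general transfer principle behind split (i) ⇒ pivot: restrict MixedTransferGaussian to
systems whose only ℂ(z)-relations have Stokes-constant coefficients and re-rank the linear rung
first. RelSchanuelOverPiLWField or PiFreeOverLWField refuted ⇒ Schanuel is false (close
`refuted:<Decl>`). PiFreeOverLWField proved by any route ⇒ this route = the shared remainder: close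
`superseded`; MixedTripleIndependent / PiFreeOverGaussianEValues stay alive as Literature-level E/Э
questions.

NOT DECOMPOSED YET. The Э-membership of J (former support item GaussianAntiEValue: J ∈
`Literature.NumberTheory.Transcendental.antiEValues`, strictness of (C(−½,n))ₙ) — a Literature-side
theorem kept out of the items so that the route file imports no Literature module (see DEFINITION
REQUESTS); it makes AntiEValueTranscendental literally Fischler–Rivoal Conj. 2 ⇒ Cor. 1 in tree
terms. The general mixed Siegel–Shidlovskii principle for vectors (E-functions, 1-summed
Э-functions) of an arbitrary E-operator (would want a typed `MixedFunction` notion, Fischler–Rivoal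
2024 Def. 1 — not requested until split (i) is filed; the explicit Gaussian system needs no new
notion); quantitative measures (a measure of algebraic independence for (e^{a}, F(a)) from
Shidlovskii's measure, and what it would give for π); the sibling Stokes constants Γ(⅓), Γ(¼) of
₁F₁(a; a+1; −z) (a = ⅓, ¼), where Chudnovsky/Nesterenko give a PROVED corner (π ⊥ Γ(¼)) to calibrate
a mixed transfer statement against; the d ≥ 2 layer of Factor 1 has no separate handle here beyond
the uniform crux; the card's negative items — the mixed-Gevrey auxiliary-polynomial cap (B1: "an E×G
Taylor-side auxiliary function caps at trdeg 1", to be written as a barrier note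
Literature/Barriers/Schanuel/MixedGevreyAuxiliaryCap) and the finite-type transfer computation at q
= 1/e (N1: log H ≍ N² log³N vs N⁴) — are refuter-side analyses explaining WHY the line lives on the
Laplace side, not items; Factor 2 (other routes own it).

CHEAPEST FALSIFIER. (1) Integer-relation search (PSLQ, 60 digits) among the 70 monomials of degree ≤
4 in (e, π, I, J), I = ∫₀¹e^{-x²}dx = 0.74682413281242…, J = ∫₀^∞e^{-x}/√(1+x)dx =
0.75787215614131…: it MUST return the built-in positive control 4e²I² + 4eIJ + J² − πe² = 0 (squared
Stokes identity) and nothing else; a second relation of height < 10¹² kills MixedTripleIndependent,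
one avoiding I kills e ⊥ π; degree ≤ 4 in (e, π, I) alone (35 monomials) tests StokesSplit's right
side. A one-minute refuter kit job (not run: planners are compute-free; √π = 2I + J/e checked to
1e-13). (2) Lookup: an unconditional proof in print that J = e·Γ(½,1) is transcendental, or that
trdeg ℚ(e, π, γ(½,1)) = 3, turns cruxes into citations (searched: F–R 2024 pp. 3–6, F–R
hal-04711290, Rivoal2012 review, frontier/bridges — conditional results only). (0) 15-minute paper
check of StokesToSector (trdeg sub-additivity) and of the shared Assembly/Exactness (GL_n(ℚ) split;
W = U ⊕ ℚ(πi + a₀) is LW alone) — a gap there breaks conformance, not the mathematics.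

NUMBERS. I = ∫₀¹e^{-x²}dx = 0.7468241328…, J = ∫₀^∞e^{-x}/√(1+x)dx = 0.7578721561…, 2I + J/e =
1.7724538509… = √π. Known: trdeg ℚ(e^{a_i}, F(a_i) : i ≤ d) = 2d for ℚ-free algebraic a
(Siegel–Shidlovskii; tree theorem + functional independence), in particular trdeg ℚ(e, I) = 2
(Shidlovskii; Rivoal2012 Thm 2: two of e^z, Γ(α)z^{-α}, 𝒢_α(z) independent for α ∈ ℚ∖ℤ, z ∈ ℚ̄, here
α = ½, z = 1); π ∉ ℚ̄ and LW (tree, proved) give trdeg ℚ(π, e^{a}) ≥ max(1, d); functional trdeg of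
(e^{-z}, F, H): 2 over ℂ(z), 3 over ℚ̄(z); of the d-point E-side: 2d over ℂ(z). Conjectured here: 2d
+ 1 with π adjoined (d = 1: trdeg ℚ(e, π, I) = 3). Fischler–Rivoal: E ∩ D = ℚ̄ (Conj. 1), Э-division
(Conj. 2) ⇒ J transcendental (Cor. 1), mixed division (Conj. 3) ⇒ rk_ℚ̄(1, e⁻¹, I, J) = 4 (Thm 4
shape). Items at open: 14 (4 cruxes, 9 supports, 1 assembly); since the cone repair (2026-08-15): 13
(support GaussianAntiEValue dropped). Import cone: Mathlib, HarnessLib, Summits.Schanuel.Statement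
only — the 12 unproved names left are the open conjectures of PeriodsWave0.lean (operator-owned
Statement import; baseline of every Schanuel route), used by no item.

DEFINITION REQUESTS. None now. The gen-1 request `AntiEFunction` LANDED
(`Literature.NumberTheory.Transcendental.AntiEFunction`: `antiESeries`, `IsAntiEFunction`,
`IsAntiESum`, `antiEValues` = Fischler–Rivoal's D, `isBorelLaplaceSum_binomial`,
`integral_mem_antiEValues_of_isStrictEFunction`) but is deliberately NOT imported by the route file
(cone repair 2026-08-15): `AntiEFunction` imports
`Literature.Barriers.Schanuel.EFunctionValuesAtAlgebraicPoints`, whose cone carries 21 unproved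
named facts no item uses (the four Exp…NotEValue facts; the NesterenkoModularScope block;
AlgIndepLogarithms, ThreeLogarithmsConjecture, roy1992_strongSixExponentials;
SoftDerivationOfSchanuel; IsZilberField.of_isExpAlgClosed; nine RHWave0 facts via PeriodsWave0Proofs
→ OddZetaFinal → ZetaLinearFormsCriterion → RHWave0PNTProofs), which kept the route unstaffed. The
one item stated over those definitions, support GaussianAntiEValue ("(C(−½,n))ₙ is a strict
E-coefficient sequence and J = ∫₀^∞e^{-t}(1+t)^{-1/2}dt ∈ 𝐃 = `antiEValues`, via
`integral_mem_antiEValues_of_isStrictEFunction`"), was dropped from the items and is re-homed as a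
Literature-side theorem: anyone may propose it sorry-free into
Literature/NumberTheory/Transcendental/ (next to AntiEFunction.lean; it is Fischler–Rivoal's own
example Γ(a) = E_{a,1}(−1) + e^{-1}Э_{a,1;0}(1) at a = ½), at no cost to this route; needs-fact:
none. Siegel–Shidlovskii (`siegelShidlovskii_algIndep_holds`), Lindemann–Weierstrass and π ∉ ℚ̄ are
PROVED in the tree and enter only through provers' Theorems files; no cite facts are needed. If
split (i) is filed later: notion `MixedFunction` (F–R 2024 Def. 1, topic
Literature/NumberTheory/Transcendental) to state their Conj. 3 / Thm 4 and the general mixed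
transfer principle.

Novelty: Searches (2026-08-15): `lit read arXiv:2301.13518` pp. 3–6 (Thm 1 "the number π could be similarly
expressed" as a ℚ̄-polynomial in E and D;
Conj. 1–3; Thm 3, 4; Prop. 3; "no hope … transcendence degree … mixed functions"); `lit read
doi:10.5802/xups.2019-01` (Fresan2024) pp. 26–27
(Ex. 2.9 "on s'attend à ce que les e^α soient transcendants sur le corps engendré par toutes les
périodes usuelles", Ex. 2.10 √π exponential period);
`lit search --hybrid "exponential period conjecture e and pi algebraically independent exponential
motives"` (12 docs, vector leg only: Huber–Wüstholz,
Chudnovsky1984 — nothing on E/Э); `lit search --hybrid "Shidlovskii algebraic independence values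
E-functions incomplete gamma …"` (10: Baker1975
Ch. 11 read pp. 103–104, 110 — "the main outstanding problem … wider classes than E-functions";
NP2001; Baker1988); `lit search --source zbmath
"algebraic independence values E-functions linear differential equations first order"` (8:
Shidlovskii 1987/1997, Salikhov 1973 doi:10.1007/bf01093623,
Fel'dman–Nesterenko EMS 44); `lit galaxy search "values of E-functions at algebraic points" --star
all` (3: Natarajan–Thangadurai 'Pillars', Erdős
Turán volume, Fischler–Rivoal hal-04711290 'logarithms of E-functions' — read pp. 1–3: Thm 1/Cor. 1
on log f(ξ), cites BBH Cor. 4.6; nothing on π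
over E-value fields); `lit galaxy search "Stokes constant transcendental" --star all` (0); `lit
frontier Schanuel --since 2021` (30: Zilber–Pink,
odd zeta, elliptic Schanuel proper  [refs: 10.5802/xups.2019-01`, 10.1007/bf01093623, 10.1307/mmj/1339011525, 2301.13518, 2504.14041, 2601.18474, doi:10.5802/xups.2019-01, doi:10.1007/bf01093623, doi:10.1307/mmj/1339011525, Fresan2024, Chudnovsky1984, Baker1975, FischlerRivoal2024, Rivoal2012, Shidlovskii1989, FresanJossen2020]

Barriers (technique_class: siegel-shidlovskii e-functions anti-e-functions stokes): - technique_class: siegel-shidlovskii e-functions anti-e-functions stokes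
- Literature.Barriers.Schanuel.EFunctionValuesAtAlgebraicPoints: engaged head-on and evaded by
enlarging the class of FUNCTIONS, not of points: every number in the attack (e^{a}, F(a), H(a)) is
the value at an algebraic point of a solution of a linear ODE over ℚ̄(z); π enters only as the
Stokes constant √(πa) = 2aF(a) + e^{-a}H(a), i.e. through the 1-summed Э-solution H, outside the
barrier's explicit class (`eValues` of strict E-functions) — the bet is that Siegel's arithmetic
transfer survives for the mixed system although mixed products are not a ring (Fischler–Rivoal's
stated obstruction); the proved half of the barrier (`siegelShidlovskii_algIndep_holds`) is USED for
the known 2d.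
- Literature.Barriers.Schanuel.NesterenkoModularScope: not used — no modular/q-series input; the
card's Tate-curve reading (Nesterenko at q = 1/e certifies 3 of the 5 invariants of ℂ^×/e^ℤ and
structurally loses the one carrying (e, π)) is the recorded reason the modular corner is avoided,
not an ingredient.
- Literature.Barriers.Schanuel.LargeTranscendenceDegree: not engaged at open — no Philippon
criterion / measure bookkeeping; the +1 is sought as a qualitative Beukers-type transfer (relations
lift to functional relations); conceded that any quantitative version (measures for mixed values)
would meet it.
- Literature.Barriers.Schanuel.PeriodConjectureOverQbarScope: consistent — the attack stays over ℚ̄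
but on the EXPON

History (route lifecycle, newest last):
- 2026-08-15T19:29:55Z · rev 1: dropped GaussianAntiEValue — cone repair (route-repair seat): drop import Literature.NumberTheory.Transcendental.AntiEFunction (→ Literature.Barriers.Schanuel.EFunctionValuesAtAlgebraicPoin (planner-rrepair-Schanuel-GaussianStokesSector-e04415a3-0)
- 2026-08-16T02:19:15Z · AUTO-CRUX: 1 conjecture-grade item(s) promoted to crux (AntiEValueTranscendental) — refuter vetting / tiering apply (operator:999:1362873)
- 2026-08-24T08:57:56Z · DORMANT — reconciler: no traction for 6.6 d (last activity item-evidence-added at 2026-08-17T16:54:20Z); parked, not closed — `ledger route dormant route-Schanuel-Gaussia (operator:999:1988143)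

sub-problem: Schanuel · status: dormant · opened planner-plancard-Schanuel-Schanuel-e-pi-obstr-991047b5-g2-0 2026-08-15T19:03:00Z · rev 3 · ledger route-Schanuel-GaussianStokesSector
GENERATED by the gate from the ledger (D-0016/17). Provers cite these decls: `theorem foo : Summit.Schanuel.Schanuel.Theses.GaussianStokesSector.<Decl> := …` in Summits/Schanuel/Schanuel/Theorems/<Name>.lean.
-/

namespace Summit.Schanuel.Schanuel.Theses.GaussianStokesSector

open scoped BigOperators Topology Manifold Classical MeasureTheory ProbabilityTheory Matrix InnerProductSpace ComplexConjugate ContinuousMap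
open Filter Set Function TopologicalSpace MeasureTheory

attribute [summit_statement] _root_.Schanuel

open Literature.Periods

/-- item stmt-Schanuel-13739 · crux · rank 2 · open · by planner
why it might fail: Stronger than Factor 1 and NOT implied by Schanuel (F-values lie outside exp/log): false iff π ∈ ℚ(e^{a},F(a))^alg for some a; products of mixed functions are not mixed, so no method in print yields trdeg of mixed values (F–R 2024: 'no hope' by Beukers' route).
sources: FischlerRivoal2024, arXiv:2301.13518, Rivoal2012, Shidlovskii1989, Andre2000GevreyI, Fresan2024
[crux] for every d and every ℚ-linearly independent family of algebraic numbers a₁,…,a_d, trdeg_ℚ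
ℚ(π, e^{a₁},…,e^{a_d}, F(a₁),…,F(a_d)) ≥ 2d + 1 with F(a) = ∫₀¹ e^{-a x²}dx = ₁F₁(½; 3⁄2; −a): π is
transcendental over the field generated by the Lindemann–Weierstrass values and the Gaussian
E-values (equivalently, by √(πa_j) = 2a_jF(a_j) + e^{-a_j}H(a_j): the field of ALL values, E and Э,
of the mixed system at the points a_i has transcendence degree 2d + 1 = its functional transcendence
degree over ℚ̄(z)). The 2d part is GaussianEValuesIndependent (known); the crux is the +1. d = 1, a
= 1 is MixedTripleIndependent (InstanceFromSector + StokesSplit); dropping the F's gives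
PiFreeOverLWField (StokesToSector). Card items (4a)/C1 lifted to the sector. [difficulty:
open-problem] -/
@[route_item "route-Schanuel-GaussianStokesSector", crux]
def PiFreeOverGaussianEValues : Prop :=
  ∀ (d : ℕ) (a : Fin d → ℂ), (∀ i, IsAlgebraic ℚ (a i)) → LinearIndependent ℚ a → ((2 * d + 1 : ℕ) : Cardinal) ≤ Algebra.trdeg ℚ ↥(IntermediateField.adjoin ℚ (insert (Real.pi : ℂ) (Set.range (Complex.exp ∘ a) ∪ Set.range (fun i => ∫ x in (0:ℝ)..1, Complex.exp (-(a i * (x : ℂ) ^ 2))))))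

/-- item stmt-Schanuel-13740 · crux · rank 3 · open · by planner
why it might fail: Formally stronger than e ⊥ π (adds I); fails iff √π ∈ ℚ(e, I)^alg; unconditionally only trdeg ℚ(e, I) = 2 is known, the linear and Э rungs are conditional (F–R Thm 4 / Cor. 1 under Conj. 3 / 2), and J could be algebraic without contradicting any theorem.
sources: Rivoal2012, FischlerRivoal2024, arXiv:2301.13518, Shidlovskii1989, Lagarias2013EulerConstant
[crux] e, I := ∫₀¹ e^{-x²}dx (the Gaussian E-value F(1) = γ(½,1)/2) and J := ∫₀^∞ e^{-x}/√(1+x) dx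
(the Gaussian Э-value H(1) = e·Γ(½,1)) are algebraically independent over ℚ — the values at z = 1 of
the solutions e^{-z}, F, H of one linear ODE over ℚ(z); by StokesSplit equivalent to trdeg ℚ(e, π,
∫₀¹e^{-x²}dx) = 3, hence it contains e ⊥ π. Card item C1 ("3 numbers, 2 of 3 known": trdeg ℚ(e, I) =
2 is Shidlovskii's theorem / Rivoal2012 Thm 2); the d = 1, a = 1 case of PiFreeOverGaussianEValues
and the first test-bed for any Э-value technology (Fischler–Rivoal Conj. 2–3, resurgence, the
tensor-mixed card). [difficulty: open-problem] -/
@[route_item "route-Schanuel-GaussianStokesSector", crux]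
def MixedTripleIndependent : Prop :=
  AlgebraicIndependent ℚ ![Real.exp 1, ∫ x in (0:ℝ)..1, Real.exp (-x ^ 2), ∫ x in Set.Ioi (0:ℝ), Real.exp (-x) / Real.sqrt (1 + x)]

/-- item stmt-Schanuel-18738 · crux · rank 3 · open · by planner
why it might fail: No theorem gives transcendence of an E-value over a TRANSCENDENTAL base: Siegel–Shidlovskii/Beukers see ℚ̄-coefficients only, relative versions over arbitrary k ⊂ ℂ are false (k = ℚ(F(a))); false iff some F(a) is algebraic over ℚ(π, e^a) — that kills PiFreeOverGaussianEValues at d = 1, not Schanuel.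
sources: arXiv:2301.13518, FischlerRivoal2024, Rivoal2012, Shidlovskii1989, BakerTNT1975, FresanJossen2020
[crux] piece X₂ of the BC2-redirect split of MixedTripleIndependent (crux-strategist r1): for every
real algebraic a > 0 the Gaussian E-value F(a) = ∫₀¹ e^{-a x²} dx = ₁F₁(½; 3⁄2; −a) = γ(½, a)/(2√a)
is transcendental over the field ℚ(e^a, π) — the SCHANUEL-FREE half of the rank-2 crux
PiFreeOverGaussianEValues at d = 1 (tower law: trdeg ℚ(π, e^a, F(a)) = 3 ⟺ (π ⊥ e^a) ∧ X₂(a)),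
uniform in the algebraic point like every Siegel–Shidlovskii statement. In a world where π ∈
ℚ(e^a)^alg, X₂(a) IS Shidlovskii's theorem trdeg ℚ̄(e^a, F(a)) = 2 (Siegel–Shidlovskii for the
E-functions e^{-az}, F(az); BakerTNT1975 Thm 11.1, Rivoal2012 Thm 2), so X₂ carries no instance of
Schanuel; at a = 1 and given EPiAlgIndependent it yields MixedTripleIndependent (glue PROVED: a = 1,
option_iff_transcendental over K = ℚ(e, I), Stokes identity √π = 2I + J/e puts π in the relative
algebraic closure of K(J)). Natural parent conjecture: a π-RELATIVE SHIDLOVSKII transfer (functional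
transcendence of F over ℂ(z, e^{-z}) ⇒ transcendence of F(a) over ℚ̄(π)(e^a)); all numbers involved
are exponential periods. [difficulty: open-problem] (why it might fail: No theorem gives
transcendence of an E-value over a TRANSCEN -/
@[route_item "route-Schanuel-GaussianStokesSector"]
def GaussValueRelTranscendental : Prop :=
  ∀ a : ℝ, IsAlgebraic ℚ a → 0 < a → Transcendental ↥(IntermediateField.adjoin ℚ ({Real.exp a, Real.pi} : Set ℝ)) (∫ x in (0:ℝ)..1, Real.exp (-(a * x ^ 2)))

/-- item stmt-Schanuel-9548 · crux · rank 4 · open · by planner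
why it might fail: It is Schanuel off the π–LW sector verbatim (contains algebraic independence of logarithms, e ⊥ e^e relative to K₂); no mechanism of this route touches it — the honest remainder of an exact factorisation; false iff Schanuel fails for a tuple independent mod ℚ̄ ⊕ ℚπi.
sources: Waldschmidt2000, Kirby2010EAEF, Lang1966, BaysKirby2018ANT
[crux] the exact complement (Factor 2): for x₁,…,x_n ∈ ℂ ℚ-linearly independent modulo V₂ =
span_ℚ(ℚ̄ ∪ {πi}) = ℚ̄ ⊕ ℚπi, the transcendence degree of K₂(x, e^x) over K₂ = ℚ(ℚ̄ ∪ {πi} ∪ e^ℚ̄)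
is at least n — Schanuel relative to the field of the π–LW sector (same shape as
LogPatterns.OffLogSector / AdelicLogSector.OffPrimeLogSector, with which it shares all tuples off
the log lattice). Implied by Schanuel (Exactness: finite-coefficient descent K₂ → ℚ(w, e^w) for a
finite-dimensional W ∋ πi, then Schanuel at (w, x) and the tower law, using trdeg ℚ(w, e^w) ≤ dim W
on V₂). [difficulty: open-problem] -/
@[route_item "route-Schanuel-GaussianStokesSector", crux]
def RelSchanuelOverPiLWField : Prop :=
  ∀ (n : ℕ) (x : Fin n → ℂ), LinearIndependent ℚ ((Submodule.span ℚ ({z : ℂ | IsAlgebraic ℚ z} ∪ {(Real.pi : ℂ) * Complex.I})).mkQ ∘ x) → (n : Cardinal) ≤ Algebra.trdeg ↥(IntermediateField.adjoin ℚ ({z : ℂ | IsAlgebraic ℚ z} ∪ {(Real.pi : ℂ) * Complex.I} ∪ Complex.exp '' {z : ℂ | IsAlgebraic ℚ z})) ↥(IntermediateField.adjoin ↥(IntermediateField.adjoin ℚ ({z : ℂ | IsAlgebraic ℚ z} ∪ {(Real.pi : ℂ) * Complex.I} ∪ Complex.exp '' {z : ℂ | IsAlgebraic ℚ z})) (Set.range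 x ∪ Set.range (Complex.exp ∘ x)))

/-- item stmt-Schanuel-18739 · crux · rank 5 · open · by planner
why it might fail: It is Schanuel's flagship open instance: false iff P(e, π) = 0 for some nonzero P ∈ ℤ[x,y]; not even e+π ∉ ℚ is known; refuting it refutes Schanuel and every route on the summit.
sources: Waldschmidt2000, BaysKirby2018ANT, MurtyRath2014, Lang1966, BakerTNT1975
[crux] piece X₁ of the BC2-redirect split of MixedTripleIndependent (crux-strategist r1, RESTATED
re-audit 2026-08-17): e and π are algebraically independent over ℚ — the SCHANUEL INSTANCE x = (1,
πi) hidden inside the 3-number crux (by StokesSplit MTI ⟺ trdeg ℚ(e, π, ∫₀¹e^{-x²}) = 3 ⊇ e ⊥ π),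
now an explicit shared leaf. Verbatim
`Literature.NumberTheory.Transcendental.ExpOnePiAlgebraicIndependent` (Iff.rfl; = retired
StokesConstantPi.EPi / EclCore.ExpOnePiAlgIndep); S → X₁ is LANDED
(`Literature.Barriers.Schanuel.expOnePiAlgebraicIndependent_of_schanuel`); live typed attack in the
tree: `DiophantineDichotomy.EPiSimultaneousTypeEv → X₁` (Theorems `ePiRaceEv_proof` ∘
`approximationPropertyDegOne_proof`). Glue (PROVED,
Cruxes/MixedTripleIndependent/Lines/schanuel-split.lean `MixedTripleIndependent_of`, ≈230 lines
incl. the Stokes identity): X₁ → GaussValueRelTranscendental → MixedTripleIndependent. [difficulty: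
open-problem] (why it might fail: It is Schanuel's flagship open instance: false iff P(e, π) = 0 for
some nonzero P ∈ ℤ[x,y]; not even e+π ∉ ℚ is known; refuting it refutes Schanuel and every route on
the summit.) [sources: Waldschmidt2000, BaysKirby2018ANT, MurtyRath2014, La -/
@[route_item "route-Schanuel-GaussianStokesSector"]
def EPiAlgIndependent : Prop :=
  AlgebraicIndependent ℚ ![Real.exp 1, Real.pi]

/-- item stmt-Schanuel-9545 · crux · rank 5 · open · by planner
why it might fail: Contains e ⊥ π and π ⊥ e^{√2}; nothing beyond Lindemann–Weierstrass is known for any d ≥ 1, and here it is reached only through the stronger Gaussian crux (or ExceptionalSubspaces' symmetry attack); false iff π is algebraic over some ℚ(e^{a₁},…,e^{a_d}).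
sources: Waldschmidt2000, BaysKirby2018ANT, Fresan2024, FresanJossen2020
[crux] the π–LW sector (Factor 1): for every d and every ℚ-linearly independent family of algebraic
numbers a₁,…,a_d, trdeg_ℚ ℚ(π, e^{a₁},…,e^{a_d}) ≥ d + 1, i.e. π is transcendental over the
Lindemann–Weierstrass field E = ℚ(e^α : α algebraic) (Schanuel at (πi, a₁,…,a_d); d = 0 is
Lindemann, d = 1 is π ⊥ e^α for all algebraic α ≠ 0, PROVED off ℝ ∪ iℝ by ConjugationOffAxes).
Equivalently: π has no exceptional subspace. Its d = 1 layer is decomposed now (DOneGlue: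
EndomorphismCriterion + GaloisOrbitRealised + RealAbelianResidue); d ≥ 2 has only the structural
handle ExceptionalSubspacesIntersect (the minimal exceptional subspace is unique and symmetric).
[difficulty: open-problem] -/
@[route_item "route-Schanuel-GaussianStokesSector", crux]
def PiFreeOverLWField : Prop :=
  ∀ (d : ℕ) (a : Fin d → ℂ), (∀ i, IsAlgebraic ℚ (a i)) → LinearIndependent ℚ a → ((d + 1 : ℕ) : Cardinal) ≤ Algebra.trdeg ℚ ↥(IntermediateField.adjoin ℚ (insert (Real.pi : ℂ) (Set.range (Complex.exp ∘ a))))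

/-- item stmt-Schanuel-13747 · crux (kind.auto-crux: conjecture-grade) · rank 9 · open · by planner
why it might fail: auto-crux — conjecture-grade statement (docstring avows it ('Conjecture')); it is open, so it may simply be false
sources: FischlerRivoal2024, arXiv:2301.13518, Rivoal2012, Lagarias2013EulerConstant
[support] the Э-RUNG (weakest consequence of MixedTripleIndependent, and the refuters' handle): J =
∫₀^∞ e^{-x}/√(1+x) dx = e·Γ(½,1) is transcendental. In print only conditionally: Fischler–Rivoal
Cor. 1 (s = −½, α = 1) under their Conjecture 2; its s = −1 sibling is Gompertz's constant δ,
irrationality open. ¬AntiEValueTranscendental ⇒ √π ∈ ℚ̄(e, I) ⇒ ¬MixedTripleIndependent ⇒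
¬PiFreeOverGaussianEValues (d = 1): one algebraicity kills the route's whole attack (not Schanuel).
[difficulty: open-problem] -/
@[route_item "route-Schanuel-GaussianStokesSector", crux]
def AntiEValueTranscendental : Prop :=
  Transcendental ℚ (∫ x in Set.Ioi (0:ℝ), Real.exp (-x) / Real.sqrt (1 + x))

/-- item stmt-Schanuel-13741 · support · rank 9 · open · by planner
sources: Lang1966, Mathlib:Algebra.trdeg
[support] PiFreeOverGaussianEValues → PiFreeOverLWField: adjoining the d numbers F(a_i) to ℚ(π,
e^{a}) raises the transcendence degree by at most d, so trdeg ℚ(π, e^{a}) ≥ (2d+1) − d (tower law /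
`Algebra.trdeg` monotonicity and sub-additivity for `IntermediateField.adjoin`; pure field
bookkeeping, the glue of the route's attack on Factor 1). [difficulty: L] -/
@[route_item "route-Schanuel-GaussianStokesSector", crux]
def StokesToSector : Prop :=
  PiFreeOverGaussianEValues → PiFreeOverLWField

/-- item stmt-Schanuel-13742 · support · rank 9 · open · by planner
sources: Shidlovskii1989, doi:10.1007/bf01093623, Rivoal2012, BakerTNT1975, Rivoal2024, Literature.Barriers.Schanuel.siegelShidlovskii_algIndep_holds
[support] KNOWN (the "2d of 2d+1"): for ℚ-linearly independent algebraic a₁,…,a_d the 2d numbers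
e^{a_i}, F(a_i) = ∫₀¹e^{-a_i x²}dx are algebraically independent over ℚ. Proof route in the tree:
the coefficient sequences ((−a_i)ⁿ)ₙ and ((−a_i)ⁿ/(2n+1))ₙ are strict E-functions
(`IsStrictEFunction`: holonomy 2zF″ + (2z+3)F′ + F = 0, conjugates ≤ C^{n+1}, denominators
den(a_i)ⁿ·lcm(1,3,…,2n+1) ≤ D^{n+1}); the system T(z)Y′ = BY with T = 2z (e_i′ = −a_i e_i, 2zF_i′ =
e_i − F_i); functional algebraic independence of (z, e^{-a_i z}, F(a_i z)) over ℚ̄ (exponentials of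
ℚ-free exponents + Kolchin–Ostrowski/Liouville: no ℂ-combination of the primitives √z·F(a_i z) of
e^{-a_i z}/(2√z) lies in ℂ(√z, e^{-a_j z})); then `siegelShidlovskii_algIndep_holds` at α = 1
(independence over ℚ̄, a fortiori over ℚ). Classical: Shidlovskii's theorems on E-functions
satisfying first-order inhomogeneous equations (φ_λ, λ = ½; Salikhov 1973); d = 1: Rivoal2012 Thm 2.
[difficulty: L] -/
@[route_item "route-Schanuel-GaussianStokesSector", crux]
def GaussianEValuesIndependent : Prop :=
  ∀ (d : ℕ) (a : Fin d → ℂ), (∀ i, IsAlgebraic ℚ (a i)) → LinearIndependent ℚ a → AlgebraicIndependent ℚ (Sum.elim (fun i => Complex.exp (a i)) (fun i => ∫ x in (0:ℝ)..1, Complex.exp (-(a i * (x : ℂ) ^ 2))) : Fin d ⊕ Fin d → ℂ)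

/-- item stmt-Schanuel-13743 · support · rank 9 · open · by planner
sources: Lindemann1882, FischlerRivoal2024, Shidlovskii1989, Literature.NumberTheory.Transcendental.transcendental_pi_holds
[support] the FUNCTIONAL side of the mixed system at d = 1, provable now: no nonzero polynomial in
four variables with algebraic coefficients vanishes identically on (0, ∞) at (z, e^{-z}, F(z),
H(z)), F(z) = ∫₀¹e^{-zx²}dx, H(z) = ∫₀^∞e^{-x}(1+x/z)^{-1/2}dx — although over ℂ(z) the relation 2zF
+ e^{-z}H = √(πz) holds: trdeg is 2 over ℂ(z) and 3 over ℚ̄(z) exactly because π ∉ ℚ̄ (tree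
`transcendental_pi_holds`); proof: ℂ-independence of (√z, e^{-z}, F) + specialising the free
constant c = √π (a polynomial identity in c over ℚ̄ vanishing at the transcendental √π vanishes for
all c). This is the statement whose numerical twin at z = 1 is MixedTripleIndependent. [difficulty:
M] -/
@[route_item "route-Schanuel-GaussianStokesSector", crux]
def FunctionalIndependence : Prop :=
  ∀ P : MvPolynomial (Fin 4) ℂ, (∀ m, IsAlgebraic ℚ (P.coeff m)) → (∀ z : ℝ, 0 < z → MvPolynomial.eval ![(z : ℂ), Complex.exp (-(z : ℂ)), ((∫ x in (0:ℝ)..1, Real.exp (-(z * x ^ 2)) : ℝ) : ℂ), ((∫ x in Set.Ioi (0:ℝ), Real.exp (-x) / Real.sqrt (1 + x / z) : ℝ) : ℂ)] P = 0) → P = 0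

/-- item stmt-Schanuel-13744 · support · rank 9 · open · by planner
sources: arXiv:2301.13518, Mathlib:Real.Gamma_one_half_eq
[support] the Stokes identity at z = 1, provable now: √π = 2∫₀¹e^{-x²}dx + e⁻¹∫₀^∞e^{-x}/√(1+x)dx
(Γ(½) = √π = γ(½,1) + Γ(½,1); t = x² on (0,1), t = 1 + x on (1,∞); Mathlib `Real.Gamma_one_half_eq`,
`Real.Gamma_eq_integral`). It is Fischler–Rivoal's Γ(a) = E_{a,1}(−1) + e^{-1}Э_{a,1;0}(1) at a = ½
and exhibits √π ∈ ℚ̄[E, D] (their Thm 1 for the G-value π). Checked numerically to 1e-13 (I =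
0.7468241328…, J = 0.7578721561…). [difficulty: provable-now] -/
@[route_item "route-Schanuel-GaussianStokesSector", crux]
def StokesIdentity : Prop :=
  Real.sqrt Real.pi = 2 * (∫ x in (0:ℝ)..1, Real.exp (-x ^ 2)) + (Real.exp 1)⁻¹ * ∫ x in Set.Ioi (0:ℝ), Real.exp (-x) / Real.sqrt (1 + x)

/-- item stmt-Schanuel-13745 · support · rank 9 · open · by planner
sources: arXiv:2301.13518, Mathlib:AlgebraicIndependent
[support] provable now from StokesIdentity: MixedTripleIndependent ↔ (e, π, ∫₀¹e^{-x²}dx)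
algebraically independent — ℚ(e, I, J) = ℚ(e, I, √π) since J = e(√π − 2I) and √π = 2I + J/e, and
adjoining √π or π gives the same algebraic closure. [difficulty: M] -/
@[route_item "route-Schanuel-GaussianStokesSector", crux]
def StokesSplit : Prop :=
  MixedTripleIndependent ↔ AlgebraicIndependent ℚ ![Real.exp 1, Real.pi, ∫ x in (0:ℝ)..1, Real.exp (-x ^ 2)]

/-- item stmt-Schanuel-13746 · support · rank 9 · open · by planner
sources: Mathlib:Algebra.trdeg, Mathlib:AlgebraicIndependent
[support] bookkeeping, provable now: PiFreeOverGaussianEValues at d = 1, a = (1) gives trdeg ℚ(π, e,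
∫₀¹e^{-x²}dx) ≥ 3 inside ℂ, hence the three generators are algebraically independent, and the real
triple (e, π, ∫₀¹e^{-x²}dx) is algebraically independent over ℚ (transport along the injective
algebra map ℝ → ℂ; the complex integral ∫₀¹ e^{-(1·x²)} is the image of the real one). With
StokesSplit: PiFreeOverGaussianEValues ⇒ MixedTripleIndependent (kernel-checked composition in the
planner sketch). [difficulty: L] -/
@[route_item "route-Schanuel-GaussianStokesSector", crux]
def InstanceFromSector : Prop :=
  PiFreeOverGaussianEValues → AlgebraicIndependent ℚ ![Real.exp 1, Real.pi, ∫ x in (0:ℝ)..1, Real.exp (-x ^ 2)]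

/-- item stmt-Schanuel-18757 · support · rank 9 · open · by planner
[support] SPLIT GLUE of crux MixedTripleIndependent (crux-strategist r1, RESTATED re-audit
2026-08-17, BC2 REDIRECT; the formal `route edit --split` is reserved by the gate for a seat's final
cycle, so — as for KZ HermiteRigidity.ReductionRigidityOfCubes — the decomposition is filed as items
and a later `--split MixedTripleIndependent --into EPiAlgIndependent GaussValueRelTranscendental
--glue-by …` attaches to them by normalised signature): EPiAlgIndependent →
GaussValueRelTranscendental → MixedTripleIndependent. PROVED (≈230 lines, no sorry, axioms
propext/Classical.choice/Quot.sound) as `mixedTripleIndependent_of_pieces` in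
Cruxes/MixedTripleIndependent/Lines/schanuel_split.lean @8a510b99cc22 (registered skeleton,
`skeleton check` OK; evidence on stmt-Schanuel-13740): specialise X₂ at a = 1; tower law
(`AlgebraicIndependent.option_iff_transcendental` ×3 with reindexings) over K = ℚ(e, I); the STOKES
IDENTITY √π = 2∫₀¹e^{-x²} + e⁻¹∫₀^∞e^{-x}/√(1+x) — proved there from Mathlib's
`integral_gaussian_Ioi`, `intervalIntegral.integral_interval_add_Ioi` and
`integral_comp_mul_deriv_Ioi` with u = x² − 1 (this also proves support item StokesIdentity) — puts
√π, hence π, in the relative al -/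
@[route_item "route-Schanuel-GaussianStokesSector"]
def MixedTripleOfSchanuelSplit : Prop :=
  EPiAlgIndependent → GaussValueRelTranscendental → MixedTripleIndependent

/-- item stmt-Schanuel-9556 · support · rank 9 · closed · proved by Summit.Schanuel.Schanuel.Theorems.RigidCore.stub_exactness @ f7a9eb132f61 (prover) · by planner
sources: Waldschmidt2000, Kirby2010EAEF, Literature.NumberTheory.Transcendental.schanuelConjecture_iff_ecl_empty_holds
[support] the factorisation loses nothing, provable now (L): Schanuel ⇒ PiFreeOverLWField (Schanuel
at (πi, a₁,…,a_d), ℚ-free because π is transcendental; e^{πi} = −1 and i, a_j algebraic, so trdeg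
ℚ(π, e^a) ≥ d + 1) and Schanuel ⇒ RelSchanuelOverPiLWField (if trdeg_{K₂} K₂(x, e^x) < n, the
finitely many algebraic dependences over K₂ have coefficients in ℚ(w, e^w) for a basis w of some
finite-dimensional W ⊂ V₂ containing πi; (w, x) is ℚ-free, Schanuel gives trdeg ℚ(w, x, e^w, e^x) ≥
dim W + n while trdeg ℚ(w, e^w) ≤ dim W on V₂ — tower law, contradiction). Hence X ⟺ Schanuel.
[difficulty: L] -/
@[route_item "route-Schanuel-GaussianStokesSector", crux]
def Exactness : Prop :=
  Schanuel → PiFreeOverLWField ∧ RelSchanuelOverPiLWField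

/-- item stmt-Schanuel-9557 · assembly · rank 1 · closed · proved by Summit.Schanuel.Schanuel.Theorems.RigidCore.SectorGlue.gaussianStokesSector_assembly @ fdd69f32c02b (prover) · by planner
sources: Kirby2010EAEF, Waldschmidt2000, Literature.NumberTheory.Transcendental.schanuelConjecture_iff_ecl_empty_holds
[assembly] PiFreeOverLWField → RelSchanuelOverPiLWField → Schanuel (GL_n(ℚ) split along V₂ = ℚ̄ ⊕
ℚπi + tower law + Lindemann–Weierstrass). -/
@[route_item "route-Schanuel-GaussianStokesSector", crux]
def Assembly : Prop :=
  PiFreeOverLWField → RelSchanuelOverPiLWField → Schanuel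

/-! D-0027 §2.1 — DECIDING THEOREM (planner-authored via `route open/edit --closes-file`; by planner-rrepair-Schanuel-GaussianStokesSector-e04415a3-0 2026-08-15T19:29:55Z):
its hypotheses are this route's items and its conclusion the sub-problem Statement (glue_lint), and it elaborates with this file. -/

@[closes "route-Schanuel-GaussianStokesSector"] theorem closes (hPiFreeOverGaussianEValues : PiFreeOverGaussianEValues) (_hMixedTripleIndependent : MixedTripleIndependent)
    (hRelSchanuelOverPiLWField : RelSchanuelOverPiLWField) (_hPiFreeOverLWField : PiFreeOverLWField)
    (hStokesToSector : StokesToSector) (_hGaussianEValuesIndependent : GaussianEValuesIndependent)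
    (_hFunctionalIndependence : FunctionalIndependence) (_hStokesIdentity : StokesIdentity) (_hStokesSplit : StokesSplit)
    (_hInstanceFromSector : InstanceFromSector) (_hAntiEValueTranscendental : AntiEValueTranscendental)
    (_hExactness : Exactness) (hAssembly : Assembly) : _root_.Schanuel :=
  hAssembly (hStokesToSector hPiFreeOverGaussianEValues) hRelSchanuelOverPiLWField

end Summit.Schanuel.Schanuel.Theses.GaussianStokesSector
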